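/-
COR-CM (cell pub-hodgecm2, stage 2 of the Hodge ladder) — junction B01, leaf B01-O: VACUITY / STRENGTH WITNESS for the meeting-form
displays (x2 lane `CorCM/B01/FaceWedgeOverlap*.lean`, lead NAMING RULING HOME/INBOX l.4194 (3); filed on the OWNER WORD of
own-b01 g2, HOME/INBOX 2026-08-21T19:12:38Z «YES: file `CorCM/B01/FaceWedgeOverlapMeetingVacuity.lean`»).  KERNEL CONTENT AUTHORED by
planner-pub-hodgecm2-b01-idea-2-g20-0 (`HOME/b01/IDEA-2u-Sketch.lean` md5 568143509a8f, farm rc 0 · 0 warn · 0 sorry · trio; memo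
`HOME/b01/IDEA-2u-junk-setting-sandwich.md` 7eb197c99caa), concurred by planner-pub-hodgecm2-b01-idea-1-g20-0 (IDEA-1t «span gauge»);
brought to DEF-FREE tree form (the junk setting is an EXISTENCE THEOREM; the binder `hM` and the coupling sentence are written INLINE,
no new displayed `def` — own-b01 19:12:38Z (a) «`FaceMeetCoupling` as a NEW displayed def: NO») and FILED by seat
prover-pub-hodgecm2-b01-x2-g3-0 (b01-x2 gen 3), 2026-08-21.  Theorems only: no `def`, no instance, no cite binder, nothing cited as a
record, nothing asserted, no `sorry`; `Interfaces.lean` (C1), the E term, `Transposition/*`, `Prior/*` and the other `CorCM/B01/*` files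
untouched.  T5: every theorem below is an EXISTENCE or an IFF statement with at most the four model-universe records as hypotheses —
no multi-binder display is filed here (T5 n/a; the `iff` IS the consistency certificate for the display `hc_cm_of_supply_of_settingMeetSat_embOf_rec`).
FRAMING (COORDINATOR RULINGS 2026-08-21T11:55:35Z / 19:05:27Z / 19:17:21Z): HC_CM is NOT proved; hM is DISPLAYED in the tree and counts
by record only after the red team's SIGNED EQUAL line; nothing below discharges anything.
-/
import Summits.HodgeConjecture.CorCM.B01.FaceWedgeOverlapBypassMeeting
import HarnessLib

/-!
# T-junk as a tree fact: the isolation-setting interface is saturating-junk-inhabitable, and what `hM` then says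

(1) **`exists_saturating_isolationSetting`** — over EVERY complex Hilbert space `HG` the abstract interface
`Perl34.IsolationSetting H HG CG G SK SigIdx SigIdxG` (`CorCM/Prior/Perl34IsolationSetting.lean`) is inhabited with `H = CG = SK := HG`,
`G = SigIdx = SigIdxG := Unit`, `R := 1`, rank-one theta operators `𝒯_Φ f = ⟪Φ, f⟫ Φ`, `ϑ_χ(Φ) = Φ`, every character allowed, and
`S₁₂ = S₃₄ = ⊤`.  So «an isolation setting over `L²([U(V)])` with `H_chars`, `H_occ` and PerL Thm 3.7's conclusion `S₁₂ = S₃₄` EXISTS»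
is true for junk reasons and is never progress on item (v) / B01-O; content enters ONLY through what is asked of the setting's own `ϑ`'s.
(2) **`settingMeetSat_iff_meetCoupling`** — the binder `hM` of the x2 display `Model.hc_cm_of_supply_of_settingMeetSat_embOf[_rec]`
(`FaceWedgeOverlapBypassMeeting.lean` :260–285 / :302–327, p295997; TOKEN FOR TOKEN below) is EQUIVALENT on every model universe to the
setting-free, `embOf`-free cohomological coupling sentence «at every admissible face context `(F, f, ι₁, V)`: a non-zero (12)-wedge of
`U_Ψ`-classes ⇒ `U.PeriodNV ι₁ V F f.psi ι₁`» (→: the meeting engine `Model.periodNV_of_settingMeet_embOf` at saturated theta sets;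
←: the saturating junk setting over `Lp ℂ 2 V.autMeasure`, whose `gen12MeetSat` is free (`u :=` the wedge-function itself ∈ `⊤`) and whose
`real34Meet`, with test vectors ranging over ALL of `L²`, is exactly that sentence read through `Model.embOf_inner_emb` and
`Universe.period_eq_pairing_wedges`).
(3) **`faceSupply_and_settingMeetSat_iff_perLFace`** — THE SANDWICH: `(U.FaceSupply ∧ hM) ↔ U.PerLFace` on every model universe
(B01-H = `Transposition.Model.heckeWedge10_of_heckeFamily` and the cone facts are tree theorems).  So the two displayed hypotheses of
`hc_cm_of_supply_of_settingMeetSat_embOf_rec` are a CONJUNCT SPLIT of the target `PerLFace(U_rec)` itself: not vacuous, no hidden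
strength, relatively consistent (T5: `False` from `{hS, hM}` would be `¬ PerLFace(U_rec)`); `hM` is strictly weaker than B01-C
`FaceSeesawCoupling` and than B01-O `FaceWedgeOverlap` as hypotheses.
READING FOR HM-EQUALITY (coordinator 19:05:27Z (1) / 19:17:21Z Δ3): every per-face display whose isolation setting is ∃-BOUND (tree
`hc_cm_of_jointThetaPin_meeting_rec` p292271, its abstract twin, `hc_cm_of_supply_of_settingMeetSat_embOf_rec` p295997,
`…_exhaustion_pairSettingMeet_embOf_rec` p296878, the pinned compositions) is `PeriodNV`-strength: the ∃S and C5′/`H_chars`/`H_occ`/`S₁₂ = S₃₄`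
sub-clauses are kernel-decorative and must not be counted as separate obligations; the by-record discharge from the package
(`HodgeCM/Model/EndStateMeet.lean`:353/:238/:245) is a statement about the package's PINNED operators `T.t12`/`T.t34` (right regular
representation, theta kernel, toric theta vectors), which is where PerL §3 is load-bearing.  HC_CM is NOT proved.
-/

noncomputable section

set_option autoImplicit false

open scoped TensorProduct InnerProductSpace
open MeasureTheory
open Literature.AlgebraicGeometry.HodgeTheory
open Literature.NumberTheory.Automorphic
open Literature.NumberTheory.Automorphic.PicardCM

namespace Summit.HodgeConjecture.CorCM

open Literature.AlgebraicGeometry.Motives (CMType HodgeStructure)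
open Literature.AlgebraicGeometry.Motives.HodgeStructure (conj)
open Prior.Perl34File (Perl34.IsolationSetting Perl34.IsolationCore Perl34.TorusData)
open Prior.Perl34File.Perl34

/-! ## §1  T-junk: a SATURATING isolation setting over any complex Hilbert space -/

/-- **The isolation-setting interface is saturating-junk-inhabitable.**  Over every complex Hilbert space `HG` there is
`S : Perl34.IsolationSetting HG HG HG Unit HG Unit Unit` (core: `R := 1`, `ω(h) := id`, `𝒯_Φ f := ⟪Φ, f⟫ Φ`, `C([G_U]) ⊆ L²` the identity,
one isotypic component `⊤` on each side, all projections `1`; both torus sides: one allowed character, `ϑ_χ(Φ) := Φ`, `E^χ_f := f`,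
`S₁₂ := ⊤`, `P_w := 1`) with `S.t12.S12 = S.t34.S12 = ⊤`, every character allowed, and `S.t12.ϑ χ Φ = S.t34.ϑ χ Φ = Φ`.  Every axiom
field is a triviality of Hilbert-space algebra; PerL Thm 3.7's conclusion `S₁₂ = S₃₄` is EMPTY for it.  Consequence: an ∃-bound
isolation setting carries no content by itself (idea-2 IDEA-2u T-junk; idea-1 IDEA-1t span gauge). [folklore] -/
theorem exists_saturating_isolationSetting (HG : Type) [NormedAddCommGroup HG] [InnerProductSpace ℂ HG] [CompleteSpace HG] :
    ∃ S : Perl34.IsolationSetting HG HG HG Unit HG Unit Unit,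
      S.t12.S12 = ⊤ ∧ S.t34.S12 = ⊤ ∧ (∀ χ, S.t12.allowed χ) ∧ (∀ χ, S.t34.allowed χ) ∧
        (∀ χ (Φ : HG), S.t12.ϑ χ Φ = Φ) ∧ (∀ χ (Φ : HG), S.t34.ϑ χ Φ = Φ) := by
  -- Step 1: the junk CORE, remembered only through four equations
  obtain ⟨C, hT, hincl, hR, homg⟩ : ∃ C : Perl34.IsolationCore HG HG HG Unit HG Unit Unit,
      (∀ Φ f : HG, C.TΦ Φ f = (⟪Φ, f⟫_ℂ) • Φ) ∧ (∀ Φ : HG, C.inclCG Φ = Φ) ∧ (∀ (g : Unit) (v : HG), C.R g v = v) ∧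
        (∀ (g : Unit) (Φ : HG), C.omg g Φ = Φ) := by
    refine ⟨{ R := 1
              R_unitary := fun g u v => rfl
              omg := fun _ Φ => Φ
              TΦc := fun Φ => (innerSL ℂ Φ).smulRight Φ
              inclCG := ContinuousLinearMap.id ℂ HG
              hatσ := fun _ => ⊤
              hatσ_closed := fun _ => by simp
              hatσ_invariant := fun _ _ _ _ => Submodule.mem_top
              hatσ_ortho := fun _ _ h _ _ _ _ => (h rfl).elim
              hatσ_complete := top_unique
                ((le_iSup (fun _ : Unit => (⊤ : Submodule ℂ HG)) ()).trans (Submodule.le_topologicalClosure _))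
              eσ := fun _ => 1
              eσ_mem := fun _ _ => Submodule.mem_top
              eσ_fix := fun _ _ _ => rfl
              eσ_selfAdjoint := fun _ _ _ => rfl
              AX9_espectral := fun _ _ _ _ _ hv => by simpa using hv
              hatτ := fun _ => ⊤
              hatτ_closed := fun _ => by simp
              hatτ_complete := top_unique
                ((le_iSup (fun _ : Unit => (⊤ : Submodule ℂ HG)) ()).trans (Submodule.le_topologicalClosure _)) },
      fun Φ f => ?_, fun Φ => rfl, fun g v => rfl, fun g Φ => rfl⟩
    simp [Perl34.IsolationCore.TΦ]
  -- Step 2: the junk TORUS SIDE over that core, remembered through three facts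
  obtain ⟨D, hS12, hall, hocc, hϑ⟩ : ∃ D : Perl34.TorusData C,
      D.S12 = ⊤ ∧ (∀ χ, D.allowed χ) ∧ (∀ i, D.wOccurs i) ∧ ∀ χ (Φ : HG), D.ϑ χ Φ = Φ := by
    refine ⟨{ X := Unit
              TestFn := HG
              allowed := fun _ => True
              ϑc := fun _ Φ => Φ
              E := fun _ f => f
              S12 := ⊤
              S12_def := ?_
              wOccurs := fun _ => True
              Pw := 1
              Pw_idem := by ext v; rfl
              Pw_selfAdjoint := fun _ _ => rfl
              AX5b_ϑ_cont := fun _ => continuous_id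
              AX12_transl_cont := fun _ _ => continuous_of_discreteTopology
              ETransl := fun _ _ f => f
              AX12_E_transl := fun h χ f => hR h f
              AX12_unfold_lift := fun Φ χ f => ?_
              AX12_molly := fun χ Φ => ?_
              AX8_annihilation := fun v hv => ?_
              AX9_w_vector := fun M _ _ i _ hne => ?_ },
      rfl, fun _ => trivial, fun _ => trivial, fun χ Φ => hincl Φ⟩
    · -- `S₁₂ = ⊤` IS the closed span of all `ϑ_χ(Φ) = Φ`
      refine (top_unique fun u _ => Submodule.le_topologicalClosure _ (Submodule.subset_span ?_)).symm
      exact ⟨(), trivial, u, (hincl u).symm⟩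
    · -- AX12 unfolding: `𝒯_Φ f = ⟪Φ, f⟫ Φ` lies in the span of the single translate `ϑ_χ(ω(·)Φ) = Φ`
      rw [hT]
      refine Submodule.le_topologicalClosure _ (Submodule.smul_mem _ _ (Submodule.subset_span ⟨(), ?_⟩))
      change C.inclCG (C.omg () Φ) = Φ
      rw [homg, hincl]
    · -- AX12 approximate identity: `Φ = 𝒯_Φ (⟪Φ,Φ⟫⁻¹ Φ)` (or `Φ = 0 = 𝒯_Φ 0`)
      apply subset_closure
      rw [hincl]
      by_cases hΦ : Φ = 0
      · refine ⟨0, ?_⟩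
        change C.TΦ Φ 0 = Φ
        rw [hT, hΦ, smul_zero]
      · refine ⟨(⟪Φ, Φ⟫_ℂ)⁻¹ • Φ, ?_⟩
        change C.TΦ Φ ((⟪Φ, Φ⟫_ℂ)⁻¹ • Φ) = Φ
        rw [hT, inner_smul_right, inv_mul_cancel₀ (inner_self_ne_zero.mpr hΦ), one_smul]
    · -- AX8: a vector orthogonal to every `E^χ_f = f` is zero
      have h0 : v = 0 := inner_self_eq_zero.mp (hv () v)
      rw [h0, map_zero]
    · -- AX9: a non-zero element of `M ⊓ σ̂` is `P_w`-fixed (`P_w = 1`)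
      obtain ⟨v, hv, hv0⟩ := (Submodule.ne_bot_iff _).mp hne
      exact ⟨v, hv, hv0, rfl⟩
  -- Step 3: the setting: both sides the junk side; `H_chars`, `H_occ` trivial
  exact ⟨{ core := C, t12 := D, t34 := D
           H_chars12 := hall, H_chars34 := hall
           H_occ12 := fun _ i _ => hocc i, H_occ34 := fun _ i _ => hocc i },
    hS12, hS12, hall, hall, hϑ, hϑ⟩

namespace Model

/-! ## §2  `hM` ⟺ the setting-free cohomological coupling sentence -/

/-- **`hM` IS, in the kernel, the cohomological coupling sentence** on every model universe `picardCMUniverse hHD hI h₁ h₃`: the left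
side is the binder `hM` of `hc_cm_of_supply_of_settingMeetSat_embOf` (`FaceWedgeOverlapBypassMeeting.lean`:260–285) TOKEN FOR TOKEN;
the right side says «at every admissible face context, a non-zero (12)-wedge of `U_Ψ`-classes forces `U.PeriodNV ι₁ V F f.psi ι₁`».
(→) the meeting engine `periodNV_of_settingMeet_embOf` at the saturated theta sets `Θ_i(Γ) := U_{ψ_i}(Γ)` (`F²`-injectivity of `embOf`
from Hodge–Riemann, `embOf_ne_zero_of_two_lt`); (←) the saturating junk setting of §1 over `Lp ℂ 2 V.autMeasure`: `gen12MeetSat` is free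
(`S₁₂ = ⊤`), and `real34Meet` with `ϑ_χ(Φ) = Φ` ranging over all of `L²` is the right side read through `Model.embOf_inner_emb`
(`⟪embOf y, embOf x⟫ = c · tr(x ∪ conj y)`, `c ≠ 0`) and `Universe.period_eq_pairing_wedges`.  Hence the ∃-setting and C5′ sub-clauses
of `hM` are kernel-DECORATIVE. [folklore] -/
theorem settingMeetSat_iff_meetCoupling (hHD : exists_isReal_hodgeModel) (hI : hodgePQ_independent_of_hodgeModel)
    (h₁ : BallQuotientUniformised) (h₃ : CMAbelianVarietyRealised) :
    (∀ (F : CMField), IsGalois ℚ F → 6 ≤ Module.finrank ℚ F → ∀ (f : Face F) (ι₁ : F →+* ℂ), f.Admissible ι₁ →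
      ∀ V : HermSpace3 F ι₁,
      ∃ (H CG G SK SigIdx SigIdxG : Type) (_ : NormedAddCommGroup H) (_ : InnerProductSpace ℂ H) (_ : CompleteSpace H)
        (_ : NormedAddCommGroup CG) (_ : NormedSpace ℂ CG) (_ : Group G) (_ : TopologicalSpace G) (_ : TopologicalSpace SK)
        (S : Perl34.IsolationSetting H (Lp ℂ 2 V.autMeasure) CG G SK SigIdx SigIdxG),
        (∀ (Γ : Level V) (ω₁ ω₂ : (picardCMUniverse hHD hI h₁ h₃).CohC ((picardCMUniverse hHD hI h₁ h₃).pms F ι₁ V Γ) 1),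
          ω₁ ∈ (picardCMUniverse hHD hI h₁ h₃).Uiso Γ F (f.psi 0) ι₁ → ω₂ ∈ (picardCMUniverse hHD hI h₁ h₃).Uiso Γ F (f.psi 1) ι₁ →
            embOf hHD hI (ballQuotientUniformisedDatum_of h₁) h₃ Γ
                ((picardCMUniverse hHD hI h₁ h₃).cup2C ((picardCMUniverse hHD hI h₁ h₃).pms F ι₁ V Γ) 1 ω₁ ω₂) ≠ 0 →
              ∃ u ∈ S.t12.S12,
                ⟪embOf hHD hI (ballQuotientUniformisedDatum_of h₁) h₃ Γ
                    ((picardCMUniverse hHD hI h₁ h₃).cup2C ((picardCMUniverse hHD hI h₁ h₃).pms F ι₁ V Γ) 1 ω₁ ω₂), u⟫_ℂ ≠ 0) ∧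
        (∀ χ : S.t34.X, S.t34.allowed χ → ∀ (Φ : SK) (Γ₁ : Level V)
          (ω₁ ω₂ : (picardCMUniverse hHD hI h₁ h₃).CohC ((picardCMUniverse hHD hI h₁ h₃).pms F ι₁ V Γ₁) 1),
          ω₁ ∈ (picardCMUniverse hHD hI h₁ h₃).Uiso Γ₁ F (f.psi 0) ι₁ →
          ω₂ ∈ (picardCMUniverse hHD hI h₁ h₃).Uiso Γ₁ F (f.psi 1) ι₁ →
            ⟪embOf hHD hI (ballQuotientUniformisedDatum_of h₁) h₃ Γ₁
                ((picardCMUniverse hHD hI h₁ h₃).cup2C ((picardCMUniverse hHD hI h₁ h₃).pms F ι₁ V Γ₁) 1 ω₁ ω₂),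
              S.t34.ϑ χ Φ⟫_ℂ ≠ 0 →
              ∃ (Γ : Level V) (ω : Fin 4 → (picardCMUniverse hHD hI h₁ h₃).CohC ((picardCMUniverse hHD hI h₁ h₃).pms F ι₁ V Γ) 1),
                (∀ i, ω i ∈ (picardCMUniverse hHD hI h₁ h₃).Uiso Γ F (f.psi i) ι₁) ∧
                  ⟪embOf hHD hI (ballQuotientUniformisedDatum_of h₁) h₃ Γ
                      ((picardCMUniverse hHD hI h₁ h₃).cup2C ((picardCMUniverse hHD hI h₁ h₃).pms F ι₁ V Γ) 1 (ω 2) (ω 3)),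
                    embOf hHD hI (ballQuotientUniformisedDatum_of h₁) h₃ Γ
                      ((picardCMUniverse hHD hI h₁ h₃).cup2C ((picardCMUniverse hHD hI h₁ h₃).pms F ι₁ V Γ) 1 (ω 0) (ω 1))⟫_ℂ
                    ≠ 0))
      ↔
      (∀ (F : CMField), IsGalois ℚ F → 6 ≤ Module.finrank ℚ F → ∀ (f : Face F) (ι₁ : F →+* ℂ), f.Admissible ι₁ →
        ∀ V : HermSpace3 F ι₁,
          (∃ (Γ : Level V) (ω₀ ω₁ : (picardCMUniverse hHD hI h₁ h₃).CohC ((picardCMUniverse hHD hI h₁ h₃).pms F ι₁ V Γ) 1),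
            ω₀ ∈ (picardCMUniverse hHD hI h₁ h₃).Uiso Γ F (f.psi 0) ι₁ ∧ ω₁ ∈ (picardCMUniverse hHD hI h₁ h₃).Uiso Γ F (f.psi 1) ι₁ ∧
              (picardCMUniverse hHD hI h₁ h₃).cup2C ((picardCMUniverse hHD hI h₁ h₃).pms F ι₁ V Γ) 1 ω₀ ω₁ ≠ 0) →
          (picardCMUniverse hHD hI h₁ h₃).PeriodNV ι₁ V F f.psi ι₁)
  := by
  have hL6 : ∀ {F : CMField}, 6 ≤ Module.finrank ℚ F → 2 < Module.finrank ℚ F := fun h6 => by omega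
  constructor
  · -- (→): the meeting engine at the saturated theta sets
    intro hM F hG h6 f ι₁ hι V hlf
    obtain ⟨Γ, ω₀, ω₁, h₀, h₁', hne⟩ := hlf
    obtain ⟨H, CG, G, SK, SigIdx, SigIdxG, _, _, _, _, _, _, _, _, S, hg, hr⟩ := hM F hG h6 f ι₁ hι V
    have hF : (picardCMUniverse hHD hI h₁ h₃).cup2C ((picardCMUniverse hHD hI h₁ h₃).pms F ι₁ V Γ) 1 ω₀ ω₁ ∈
        ((picardCMUniverse hHD hI h₁ h₃).hodge ((picardCMUniverse hHD hI h₁ h₃).pms F ι₁ V Γ) 2).F 2 :=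
      Universe.cup2C_mem_F_two_of_Uiso (universeOf_fact_pull_hodge hHD hI (ballQuotientUniformisedDatum_of h₁) h₃)
        (universeOf_fact_cup2_hodge hHD hI (ballQuotientUniformisedDatum_of h₁) h₃) Γ F (f.psi 0) (f.psi 1) ι₁ h₀ h₁'
    exact periodNV_of_settingMeet_embOf hHD hI (ballQuotientUniformisedDatum_of h₁) h₃ (hL6 h6) V S
      (Θ := fun i Γ' => SetLike.coe ((universeOf hHD hI (ballQuotientUniformisedDatum_of h₁) h₃).Uiso Γ' F (f.psi i) ι₁))
      (fun _ _ => Set.Subset.rfl) ⟨Γ, ω₀, h₀, ω₁, h₁', hne⟩ hg hr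
  · -- (←): the saturating junk setting over `L²([U(V)])`
    intro hC F hG h6 f ι₁ hι V
    obtain ⟨S, hS12, -, -, -, -, -⟩ := exists_saturating_isolationSetting (Lp ℂ 2 V.autMeasure)
    refine ⟨Lp ℂ 2 V.autMeasure, Lp ℂ 2 V.autMeasure, Unit, Lp ℂ 2 V.autMeasure, Unit, Unit, inferInstance, inferInstance,
      inferInstance, inferInstance, inferInstance, inferInstance, inferInstance, inferInstance, S, ?_, ?_⟩
    · -- `gen12MeetSat` is FREE: `S₁₂ = ⊤`, `u :=` the wedge-function itself
      intro Γ ω₁ ω₂ _ _ hne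
      exact ⟨_, by rw [hS12]; exact Submodule.mem_top, inner_self_ne_zero.mpr hne⟩
    · -- `real34Meet` at the junk setting = the coupling sentence
      intro χ _ Φ Γ₁ ω₁ ω₂ hω₁ hω₂ hne
      have hcup : (picardCMUniverse hHD hI h₁ h₃).cup2C ((picardCMUniverse hHD hI h₁ h₃).pms F ι₁ V Γ₁) 1 ω₁ ω₂ ≠ 0 := by
        intro h0
        apply hne
        have hz : embOf hHD hI (ballQuotientUniformisedDatum_of h₁) h₃ Γ₁
            ((picardCMUniverse hHD hI h₁ h₃).cup2C ((picardCMUniverse hHD hI h₁ h₃).pms F ι₁ V Γ₁) 1 ω₁ ω₂) = 0 := by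
          rw [h0]; exact map_zero _
        rw [hz, inner_zero_left]
      obtain ⟨Γ, Fm, α, hα, hper⟩ := hC F hG h6 f ι₁ hι V ⟨Γ₁, ω₁, ω₂, hω₁, hω₂, hcup⟩
      have hU : ∀ i : Fin 4, (picardCMUniverse hHD hI h₁ h₃).pullC (Fm i) 1 (α i) ∈
          (picardCMUniverse hHD hI h₁ h₃).Uiso Γ F (f.psi i) ι₁ :=
        fun i => Submodule.subset_span ⟨Fm i, α i, hα i, rfl⟩
      refine ⟨Γ, fun i => (picardCMUniverse hHD hI h₁ h₃).pullC (Fm i) 1 (α i), hU, ?_⟩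
      obtain ⟨c, hc, hcΛ⟩ := embOf_inner_emb hHD hI (ballQuotientUniformisedDatum_of h₁) h₃ (hL6 h6) V Γ
      have hx := Universe.cup2C_mem_F_two_of_Uiso
        (universeOf_fact_pull_hodge hHD hI (ballQuotientUniformisedDatum_of h₁) h₃)
        (universeOf_fact_cup2_hodge hHD hI (ballQuotientUniformisedDatum_of h₁) h₃) Γ F (f.psi 0) (f.psi 1) ι₁ (hU 0) (hU 1)
      have hy := Universe.cup2C_mem_F_two_of_Uiso
        (universeOf_fact_pull_hodge hHD hI (ballQuotientUniformisedDatum_of h₁) h₃)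
        (universeOf_fact_cup2_hodge hHD hI (ballQuotientUniformisedDatum_of h₁) h₃) Γ F (f.psi 2) (f.psi 3) ι₁ (hU 2) (hU 3)
      have hper' := hper
      rw [Universe.period_eq_pairing_wedges] at hper'
      intro h0
      exact (mul_ne_zero hc hper') ((hcΛ _ _ hx hy).symm.trans h0)

/-! ## §3  The sandwich: `{B01-S, hM} ⟺ PerLFace` on every model universe -/

/-- **THE SANDWICH.**  On every model universe `U = picardCMUniverse hHD hI h₁ h₃`:  `(U.FaceSupply ∧ hM) ↔ U.PerLFace`
(`PerLFace = PeriodThmF`, `Interfaces.lean`).  (→) B01-S and B01-H (the THEOREM `Transposition.Model.heckeWedge10_of_heckeFamily`) give a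
non-zero (12)-wedge of `U_Ψ`-classes at every admissible context (`Universe.faceLineField_of_supply_of_heckeWedge10`), and `hM`, read as
the coupling sentence of §2, turns it into `PeriodNV`; (←) a non-zero period `tr((F₀^*α₀ ∪ F₁^*α₁) ∪ conj(F₂^*α₂ ∪ F₃^*α₃))` forces
`F₀^*α₀ ≠ 0 ≠ F₁^*α₁` (bilinearity) — B01-S — and trivially gives the coupling sentence, hence `hM` by §2 (←).  So the two displayed
hypotheses of `hc_cm_of_supply_of_settingMeetSat_embOf_rec` (p295997) are a CONJUNCT SPLIT of the target: `False` from them would be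
`¬ U.PerLFace`; `hM` alone is a CONSEQUENCE of the target (strictly weaker than B01-C / B01-O as a hypothesis).  Nothing is discharged:
HC_CM is NOT proved. [folklore] -/
theorem faceSupply_and_settingMeetSat_iff_perLFace (hHD : exists_isReal_hodgeModel) (hI : hodgePQ_independent_of_hodgeModel)
    (h₁ : BallQuotientUniformised) (h₃ : CMAbelianVarietyRealised) :
    ((picardCMUniverse hHD hI h₁ h₃).FaceSupply ∧
    (∀ (F : CMField), IsGalois ℚ F → 6 ≤ Module.finrank ℚ F → ∀ (f : Face F) (ι₁ : F →+* ℂ), f.Admissible ι₁ →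
      ∀ V : HermSpace3 F ι₁,
      ∃ (H CG G SK SigIdx SigIdxG : Type) (_ : NormedAddCommGroup H) (_ : InnerProductSpace ℂ H) (_ : CompleteSpace H)
        (_ : NormedAddCommGroup CG) (_ : NormedSpace ℂ CG) (_ : Group G) (_ : TopologicalSpace G) (_ : TopologicalSpace SK)
        (S : Perl34.IsolationSetting H (Lp ℂ 2 V.autMeasure) CG G SK SigIdx SigIdxG),
        (∀ (Γ : Level V) (ω₁ ω₂ : (picardCMUniverse hHD hI h₁ h₃).CohC ((picardCMUniverse hHD hI h₁ h₃).pms F ι₁ V Γ) 1),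
          ω₁ ∈ (picardCMUniverse hHD hI h₁ h₃).Uiso Γ F (f.psi 0) ι₁ → ω₂ ∈ (picardCMUniverse hHD hI h₁ h₃).Uiso Γ F (f.psi 1) ι₁ →
            embOf hHD hI (ballQuotientUniformisedDatum_of h₁) h₃ Γ
                ((picardCMUniverse hHD hI h₁ h₃).cup2C ((picardCMUniverse hHD hI h₁ h₃).pms F ι₁ V Γ) 1 ω₁ ω₂) ≠ 0 →
              ∃ u ∈ S.t12.S12,
                ⟪embOf hHD hI (ballQuotientUniformisedDatum_of h₁) h₃ Γ
                    ((picardCMUniverse hHD hI h₁ h₃).cup2C ((picardCMUniverse hHD hI h₁ h₃).pms F ι₁ V Γ) 1 ω₁ ω₂), u⟫_ℂ ≠ 0) ∧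
        (∀ χ : S.t34.X, S.t34.allowed χ → ∀ (Φ : SK) (Γ₁ : Level V)
          (ω₁ ω₂ : (picardCMUniverse hHD hI h₁ h₃).CohC ((picardCMUniverse hHD hI h₁ h₃).pms F ι₁ V Γ₁) 1),
          ω₁ ∈ (picardCMUniverse hHD hI h₁ h₃).Uiso Γ₁ F (f.psi 0) ι₁ →
          ω₂ ∈ (picardCMUniverse hHD hI h₁ h₃).Uiso Γ₁ F (f.psi 1) ι₁ →
            ⟪embOf hHD hI (ballQuotientUniformisedDatum_of h₁) h₃ Γ₁
                ((picardCMUniverse hHD hI h₁ h₃).cup2C ((picardCMUniverse hHD hI h₁ h₃).pms F ι₁ V Γ₁) 1 ω₁ ω₂),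
              S.t34.ϑ χ Φ⟫_ℂ ≠ 0 →
              ∃ (Γ : Level V) (ω : Fin 4 → (picardCMUniverse hHD hI h₁ h₃).CohC ((picardCMUniverse hHD hI h₁ h₃).pms F ι₁ V Γ) 1),
                (∀ i, ω i ∈ (picardCMUniverse hHD hI h₁ h₃).Uiso Γ F (f.psi i) ι₁) ∧
                  ⟪embOf hHD hI (ballQuotientUniformisedDatum_of h₁) h₃ Γ
                      ((picardCMUniverse hHD hI h₁ h₃).cup2C ((picardCMUniverse hHD hI h₁ h₃).pms F ι₁ V Γ) 1 (ω 2) (ω 3)),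
                    embOf hHD hI (ballQuotientUniformisedDatum_of h₁) h₃ Γ
                      ((picardCMUniverse hHD hI h₁ h₃).cup2C ((picardCMUniverse hHD hI h₁ h₃).pms F ι₁ V Γ) 1 (ω 0) (ω 1))⟫_ℂ
                    ≠ 0)))
      ↔ (picardCMUniverse hHD hI h₁ h₃).PerLFace := by
  rw [settingMeetSat_iff_meetCoupling hHD hI h₁ h₃]
  constructor
  · rintro ⟨hS, hC⟩ F hG h6 f ι₁ hι V
    exact hC F hG h6 f ι₁ hι V (Universe.faceLineField_of_supply_of_heckeWedge10
      (universeOf_fact_pull_comp hHD hI (ballQuotientUniformisedDatum_of h₁) h₃)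
      (universeOf_fact_pull_hodge hHD hI (ballQuotientUniformisedDatum_of h₁) h₃) hS
      (Transposition.Model.heckeWedge10_of_heckeFamily hHD hI h₁ h₃) F hG h6 f ι₁ hι V)
  · intro h
    refine ⟨fun F hG h6 f ι₁ hι V => ?_, fun F hG h6 f ι₁ hι V _ => h F hG h6 f ι₁ hι V⟩
    -- `PeriodThmF ⇒ FaceSupply`: a non-zero period has non-zero (12)-factors
    obtain ⟨Γ, Fm, α, hα, hper⟩ := h F hG h6 f ι₁ hι V
    rw [Universe.period_eq_pairing_wedges] at hper
    refine ⟨Γ, (picardCMUniverse hHD hI h₁ h₃).pullC (Fm 0) 1 (α 0), (picardCMUniverse hHD hI h₁ h₃).pullC (Fm 1) 1 (α 1),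
      Submodule.subset_span ⟨Fm 0, α 0, hα 0, rfl⟩, Submodule.subset_span ⟨Fm 1, α 1, hα 1, rfl⟩, ?_, ?_⟩
    · intro h0
      apply hper
      simp only [h0, map_zero, LinearMap.zero_apply]
    · intro h0
      apply hper
      simp only [h0, map_zero, LinearMap.zero_apply]

#print axioms Summit.HodgeConjecture.CorCM.exists_saturating_isolationSetting
#print axioms settingMeetSat_iff_meetCoupling
#print axioms faceSupply_and_settingMeetSat_iff_perLFace

end Model

end Summit.HodgeConjecture.CorCM

end
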